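import Literature.Computability.Cryptography.GGMSimulator
import HarnessLib

/-!
# The GGM hybrid argument, IV: the Main Theorem of Goldreich–Goldwasser–Micali (discharge of `GGM1986_thm3`)

Topic `Literature/Computability/Cryptography`; last companion file of `GGM.lean`. It assembles

* `GGMHybridRuns.lean` (runs under answer rules; the lazy/eager sampling principle),
* `GGMHybridGames.lean` (the level hybrids, the simulator's pools, the telescoping identity),
* `GGMSimulatorSpec.lean` (the distinguisher `D = GGMHyb.distinguisher 𝒜 G`, specified),
* `GGMSimulator.lean` (`D` is probabilistic polynomial-time: its language is in `P`),

into `GGM1986_thm3_holds : GGM1986_thm3` — GGM 1986, §3.3, Thm. 3 (Main Theorem): for a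
length-doubling pseudorandom generator `G`, every PPT oracle adversary has negligible advantage in
the PRF game against the tree ensemble `ggmEnsemble G` (Goldreich 2001, Thm. 3.6.6).

Contents: the uniform `PMF` games of the tree (`prfRealProb`, `prfIdealProb`, `acceptPMF`) as
counting probabilities (`uProb`); the decomposition of the distinguisher's coins
`r = r_A ‖ a ‖ b ‖ r_F` (`splitEquiv`, `blocksEquivGGM`) and the re-indexing of the level and
slot bits (`sum_vector_bitsToNat`); the **exact identity**
`prfReal(n) − prfIdeal(n) = 2^{α+β} · (Pr[D(G(U_n)) = 1] − Pr[D(U_{2n}) = 1])`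
(`prfRealProb_sub_prfIdealProb_eq`; GGM 1986, p. 802; Goldreich 2001, p. 192 with Thm. 3.2.6), the
bound `prfAdvantage(n) ≤ 4(n+1)(t(n)+1) · distAdvantage D n`, and negligibility
(`SuperpolynomialDecay.polynomial_mul`, `trans_abs_le`).

## References

* O. Goldreich, S. Goldwasser, S. Micali, *How to construct random functions*, J. ACM 33 (1986)
  792–807, §3.3, Thm. 3 (Main Theorem) and its proof, pp. 800–802.
* O. Goldreich, *Foundations of Cryptography I*, CUP 2001, Thm. 3.6.6 and its proof
  (pp. 187–192), Thm. 3.2.6 (p. 140).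
-/

namespace Literature.Computability.Cryptography

open _root_.Computability Complexity Complexity.OracleAlg Filter Asymptotics Finset

namespace GGMHyb

/-! ### Uniform `PMF`s as counting probabilities -/

section Counting

variable {Ω γ : Type} [Fintype Ω] [Nonempty Ω] [DecidableEq γ]

/-- The mass of a push-forward of a uniform distribution is a counting probability. [folklore] -/
theorem toReal_map_uniform_apply (g : Ω → γ) (c : γ) :
    (((PMF.uniformOfFintype Ω).map g) c).toReal = uProb (fun ω => decide (g ω = c)) := by
  classical
  rw [← PMF.toOuterMeasure_apply_singleton ((PMF.uniformOfFintype Ω).map g) c,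
    PMF.toOuterMeasure_map_apply, PMF.toOuterMeasure_uniformOfFintype_apply, ENNReal.toReal_div,
    ENNReal.toReal_natCast, ENNReal.toReal_natCast]
  unfold uProb
  congr 2
  rw [Fintype.card_subtype]
  congr 1
  ext ω
  simp

/-- The mass of a uniform mixture is the average of the masses. [folklore] -/
theorem toReal_bind_uniform_apply {δ : Type} (q : Ω → PMF δ) (c : δ) :
    (((PMF.uniformOfFintype Ω).bind q) c).toReal = (∑ ω, (q ω c).toReal) / Fintype.card Ω := by
  rw [PMF.bind_apply, tsum_fintype,
    ENNReal.toReal_sum (fun ω _ => ENNReal.mul_ne_top (PMF.apply_ne_top _ _) (PMF.apply_ne_top _ _)),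
    Finset.sum_div]
  refine Finset.sum_congr rfl fun ω _ => ?_
  rw [ENNReal.toReal_mul, PMF.uniformOfFintype_apply, ENNReal.toReal_inv, ENNReal.toReal_natCast,
    inv_mul_eq_div]

/-- **A uniform mixture of uniform push-forwards is one counting probability on the product.**
[folklore] -/
theorem toReal_bind_uniform_map_uniform {Ω' : Type} [Fintype Ω'] [Nonempty Ω'] (f : Ω → Ω' → γ) (c : γ) :
    (((PMF.uniformOfFintype Ω).bind fun ω => (PMF.uniformOfFintype Ω').map (f ω)) c).toReal =
      uProb (fun p : Ω × Ω' => decide (f p.1 p.2 = c)) := by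
  rw [toReal_bind_uniform_apply, uProb_prod_eq_avg]
  exact congrArg₂ (· / ·) (Finset.sum_congr rfl fun ω _ => toReal_map_uniform_apply (f ω) c) rfl

/-- The probability of the impossible event. [folklore] -/
theorem uProb_false' {Ω₀ : Type*} [Fintype Ω₀] : uProb (fun _ : Ω₀ => false) = 0 := by
  simp [uProb]

end Counting

/-! ### The tree's games as counting probabilities -/

section Games

variable (𝒜 : OracleAdversary Bool) (G : List Bool → List Bool)

/-- Transport of a uniform coin space along an equality of coin counts. [folklore] -/
theorem map_uniformVector_congr' {δ : Type} (f : List Bool → δ) {k k' : ℕ} (h : k = k') :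
    (PMF.uniformOfFintype (List.Vector Bool k)).map (fun r => f r.toList) =
      (PMF.uniformOfFintype (List.Vector Bool k')).map (fun r => f r.toList) := by
  subst h; rfl

/-- The output law of an oracle adversary on `1ⁿ`, with the coin and round budgets read at `n`. [folklore] -/
theorem outputPMF_unary (O : Oracle) (n : ℕ) :
    𝒜.outputPMF O (unaryEncodeNat n) =
      (PMF.uniformOfFintype (List.Vector Bool (cA 𝒜 n))).map
        (fun r => 𝒜.alg.run O (tA 𝒜 n) (boolPair (unaryEncodeNat n) r.toList)) := by
  rw [OracleAdversary.outputPMF_eq_map, length_unaryEncodeNat_eq]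
  rfl

/-- **The real PRF game of the GGM ensemble as a counting probability** over (root key, coins).
[Goldreich 2001, Def. 3.6.4] [folklore] -/
theorem prfRealProb_eq_uProb (n : ℕ) :
    prfRealProb (ggmEnsemble G) id id 𝒜 n =
      uProb (fun p : List.Vector Bool n × List.Vector Bool (cA 𝒜 n) =>
        decide (𝒜.alg.run (oracleOfFnAt n (ggmEnsemble G n p.1.toList)) (tA 𝒜 n)
          (boolPair (unaryEncodeNat n) p.2.toList) = some true)) := by
  unfold prfRealProb prfRealPMF uniformBits
  rw [PMF.bind_map]
  simp only [Function.comp_def, id, outputPMF_unary]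
  exact toReal_bind_uniform_map_uniform _ _

/-- **The ideal PRF game as a counting probability** over (function table, coins).
[Goldreich 2001, Def. 3.6.4] [folklore] -/
theorem prfIdealProb_eq_uProb (n : ℕ) :
    prfIdealProb id id 𝒜 n =
      uProb (fun p : (List.Vector Bool n → List.Vector Bool n) × List.Vector Bool (cA 𝒜 n) =>
        decide (𝒜.alg.run (oracleOfTable p.1) (tA 𝒜 n) (boolPair (unaryEncodeNat n) p.2.toList) = some true)) := by
  unfold prfIdealProb prfIdealPMF randomFunctionPMF
  simp only [id, outputPMF_unary]
  exact toReal_bind_uniform_map_uniform _ _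

/-- The total coin count of the distinguisher at security parameter `n`. [folklore] -/
def Ltot (n : ℕ) : ℕ := cA 𝒜 n + alphaOf n + betaOf (tA 𝒜 n) + 2 * n * tA 𝒜 n

/-- The coin budget of the distinguisher on a genuine game input `⟨1ⁿ, s⟩`, `|s| = 2n`. [folklore] -/
theorem coinLenD_genuine (n : ℕ) {s : List Bool} (hs : s.length = 2 * n) :
    coinLenD 𝒜 (boolPair (unaryEncodeNat n) s).length = Ltot 𝒜 n := by
  unfold coinLenD Ltot
  have h : ((boolPair (unaryEncodeNat n) s).length - 2) / 4 = n := by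
    rw [length_boolPair, length_unaryEncodeNat_eq, hs]
    omega
  rw [h]

/-- **The distinguisher on the uniform ensemble `U_{2n}` as a counting probability** over
(sample, coins). [Goldreich 2001, Def. 3.2.2] [folklore] -/
theorem acceptPMF_distinguisher_uniform (n : ℕ) :
    (acceptPMF (distinguisher 𝒜 G) n (uniformBits (2 * n)) true).toReal =
      uProb (fun p : List.Vector Bool (2 * n) × List.Vector Bool (Ltot 𝒜 n) =>
        (distinguisher 𝒜 G).run (boolPair (unaryEncodeNat n) p.1.toList) p.2.toList) := by
  unfold acceptPMF uniformBits
  rw [PMF.bind_map]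
  have h : (fun u : List.Vector Bool (2 * n) =>
      (distinguisher 𝒜 G).outputPMF id (boolPair (unaryEncodeNat n) u.toList)) =
      fun u => (PMF.uniformOfFintype (List.Vector Bool (Ltot 𝒜 n))).map
        (fun r => (distinguisher 𝒜 G).run (boolPair (unaryEncodeNat n) u.toList) r.toList) := by
    funext u
    rw [RandAlg.outputPMF]
    exact map_uniformVector_congr' _ (coinLenD_genuine 𝒜 n u.toList_length)
  simp only [Function.comp_def, h]
  rw [toReal_bind_uniform_map_uniform]
  exact uProb_congr fun p => by simp

/-- **The distinguisher on the pseudorandom ensemble `G(U_n)` as a counting probability** over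
(seed, coins). [Goldreich 2001, Def. 3.2.2] [folklore] -/
theorem acceptPMF_distinguisher_map (hG : ∀ s, (G s).length = 2 * s.length) (n : ℕ) :
    (acceptPMF (distinguisher 𝒜 G) n ((uniformBits n).map G) true).toReal =
      uProb (fun p : List.Vector Bool n × List.Vector Bool (Ltot 𝒜 n) =>
        (distinguisher 𝒜 G).run (boolPair (unaryEncodeNat n) (G p.1.toList)) p.2.toList) := by
  unfold acceptPMF uniformBits
  rw [PMF.map_comp, PMF.bind_map]
  have h : (fun σ : List.Vector Bool n =>
      (distinguisher 𝒜 G).outputPMF id (boolPair (unaryEncodeNat n) (G σ.toList))) =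
      fun σ => (PMF.uniformOfFintype (List.Vector Bool (Ltot 𝒜 n))).map
        (fun r => (distinguisher 𝒜 G).run (boolPair (unaryEncodeNat n) (G σ.toList)) r.toList) := by
    funext σ
    rw [RandAlg.outputPMF]
    exact map_uniformVector_congr' _ (coinLenD_genuine 𝒜 n (by rw [hG, σ.toList_length]))
  simp only [Function.comp_def, h]
  rw [toReal_bind_uniform_map_uniform]
  exact uProb_congr fun p => by simp

end Games

/-! ### Splitting coin vectors -/

section Split

/-- `{0,1}^{p+q} ≃ {0,1}^p × {0,1}^q` by prefix and suffix. [folklore] -/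
def splitEquiv (p q : ℕ) : List.Vector Bool (p + q) ≃ List.Vector Bool p × List.Vector Bool q where
  toFun v := (⟨v.toList.take p, by rw [List.length_take, v.toList_length]; omega⟩,
    ⟨v.toList.drop p, by rw [List.length_drop, v.toList_length]; omega⟩)
  invFun pr := ⟨pr.1.toList ++ pr.2.toList, by rw [List.length_append, pr.1.toList_length, pr.2.toList_length]⟩
  left_inv v := List.Vector.eq _ _ (by simp)
  right_inv pr := by
    obtain ⟨a, b⟩ := pr
    refine Prod.ext (List.Vector.eq _ _ ?_) (List.Vector.eq _ _ ?_)
    · simp [List.take_left' a.toList_length]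
    · simp [List.drop_left' a.toList_length]

/-- The string of a vector is prefix followed by suffix. [folklore] -/
theorem toList_eq_splitEquiv (p q : ℕ) (v : List.Vector Bool (p + q)) :
    v.toList = ((splitEquiv p q v).1).toList ++ ((splitEquiv p q v).2).toList := by
  simp [splitEquiv]

variable (n : ℕ)

/-- Block `m + 1` of a string is block `m` of the string less its first block. [folklore] -/
theorem blkL_succ (l : List Bool) (m : ℕ) : blkL n l (m + 1) = blkL n (l.drop (2 * n)) m := by
  unfold blkL
  rw [List.drop_drop]
  congr 2
  ring

/-- Block `0` is the first `2n` symbols. [folklore] -/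
theorem blkL_zero (l : List Bool) : blkL n l 0 = l.take (2 * n) := by
  simp [blkL]

/-- A string of `t` blocks is determined by its blocks. [folklore] -/
theorem eq_of_blkL_eq : ∀ (t : ℕ) (l₁ l₂ : List Bool), l₁.length = 2 * n * t → l₂.length = 2 * n * t →
    (∀ m < t, blkL n l₁ m = blkL n l₂ m) → l₁ = l₂
  | 0, l₁, l₂, h1, h2, _ => by
    rw [Nat.mul_zero, List.length_eq_zero_iff] at h1 h2
    rw [h1, h2]
  | t + 1, l₁, l₂, h1, h2, h => by
    rw [← List.take_append_drop (2 * n) l₁, ← List.take_append_drop (2 * n) l₂]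
    have h0 := h 0 (Nat.succ_pos t)
    rw [blkL_zero, blkL_zero] at h0
    rw [h0]
    congr 1
    refine eq_of_blkL_eq t _ _ (by rw [List.length_drop, h1]; ring_nf; omega)
      (by rw [List.length_drop, h2]; ring_nf; omega) fun m hm => ?_
    rw [← blkL_succ, ← blkL_succ]
    exact h (m + 1) (Nat.succ_lt_succ hm)

/-- The length of a block of a genuine block string. [folklore] -/
theorem length_blkL {l : List Bool} {t : ℕ} (h : l.length = 2 * n * t) {m : ℕ} (hm : m < t) :
    (blkL n l m).length = 2 * n := by
  unfold blkL
  rw [List.length_take, List.length_drop, h]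
  have h1 : 2 * n * m + 2 * n ≤ 2 * n * t := by
    have := Nat.mul_le_mul_left (2 * n) (Nat.succ_le_of_lt hm)
    rwa [Nat.mul_succ] at this
  omega

/-- The blocks of a `2n·t`-bit vector. [folklore] -/
def blocksOfVec (t : ℕ) (v : List.Vector Bool (2 * n * t)) : Fin t → List.Vector Bool (2 * n) :=
  fun m => ⟨blkL n v.toList m, length_blkL n v.toList_length m.2⟩

/-- The block map is injective. [folklore] -/
theorem blocksOfVec_injective (t : ℕ) : Function.Injective (blocksOfVec n t) := by
  intro v w h
  apply List.Vector.eq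
  refine eq_of_blkL_eq n t _ _ v.toList_length w.toList_length fun m hm => ?_
  have := congrFun h ⟨m, hm⟩
  exact congrArg List.Vector.toList this

/-- **`{0,1}^{2n·t} ≃ ({0,1}^{2n})^t` by blocks.** [folklore] -/
noncomputable def blocksEquivGGM (t : ℕ) : List.Vector Bool (2 * n * t) ≃ (Fin t → List.Vector Bool (2 * n)) :=
  Equiv.ofBijective (blocksOfVec n t) ((Fintype.bijective_iff_injective_and_card _).2
    ⟨blocksOfVec_injective n t, by simp [card_vector, pow_mul]⟩)

/-- The blocks of the equivalence are the blocks of the string. [folklore] -/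
theorem blocksOf_blocksEquivGGM (t : ℕ) (v : List.Vector Bool (2 * n * t)) :
    BlocksOf n v.toList (blocksEquivGGM n t v) := fun _ => rfl

end Split

/-! ### Re-indexing the level and slot bits -/

section Bits

/-- Strings of equal length with the same binary value are equal. [folklore] -/
theorem eq_of_bitsToNat_eq : ∀ (l₁ l₂ : List Bool), l₁.length = l₂.length → bitsToNat l₁ = bitsToNat l₂ → l₁ = l₂
  | [], [], _, _ => rfl
  | [], _ :: _, h, _ => absurd h (by simp)
  | _ :: _, [], h, _ => absurd h (by simp)
  | b :: l₁, b' :: l₂, h, hv => by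
    rw [bitsToNat_cons, bitsToNat_cons] at hv
    have hb : b = b' := by
      cases b <;> cases b' <;> simp at hv ⊢ <;> omega
    subst hb
    rw [eq_of_bitsToNat_eq l₁ l₂ (by simpa using h) (by omega)]

/-- **`{0,1}^α ≃ [0, 2^α)` by binary value.** [folklore] -/
noncomputable def bitsEquiv (α : ℕ) : List.Vector Bool α ≃ Fin (2 ^ α) :=
  Equiv.ofBijective (fun v => ⟨bitsToNat v.toList, by
      have := bitsToNat_lt v.toList
      rwa [v.toList_length] at this⟩)
    ((Fintype.bijective_iff_injective_and_card _).2
      ⟨fun v w h => List.Vector.eq _ _ (eq_of_bitsToNat_eq _ _ (by rw [v.toList_length, w.toList_length])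
        (by simpa using congrArg Fin.val h)), by simp [card_vector]⟩)

/-- **A sum over bit strings is a sum over their values.** [folklore] -/
theorem sum_vector_bitsToNat {M : Type*} [AddCommMonoid M] (α : ℕ) (g : ℕ → M) :
    ∑ v : List.Vector Bool α, g (bitsToNat v.toList) = ∑ i ∈ range (2 ^ α), g i := by
  rw [← Fin.sum_univ_eq_sum_range]
  exact Fintype.sum_equiv (bitsEquiv α) _ _ fun _ => rfl

/-- A guarded sum over a range containing the guard's range. [folklore] -/
theorem sum_range_ite_lt {M : Type*} [AddCommMonoid M] {N n : ℕ} (h : n ≤ N) (f : ℕ → M) :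
    ∑ i ∈ range N, (if i < n then f i else 0) = ∑ i ∈ range n, f i := by
  rw [← Finset.sum_filter]
  congr 1
  ext i
  simp only [mem_filter, mem_range]
  omega

/-- `n ≤ 2^α` for `α = ⌊log₂ n⌋ + 1`. [folklore] -/
theorem le_two_pow_alphaOf (n : ℕ) : n ≤ 2 ^ alphaOf n :=
  (Nat.lt_pow_succ_log_self Nat.one_lt_two n).le

/-- `2^α ≤ 2(n + 1)`. [folklore] -/
theorem two_pow_alphaOf_le (n : ℕ) : 2 ^ alphaOf n ≤ 2 * (n + 1) := by
  unfold alphaOf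
  rw [pow_succ]
  rcases Nat.eq_zero_or_pos n with rfl | hn
  · simp
  · have := Nat.pow_log_le_self 2 hn.ne'
    omega

end Bits

/-! ### Dropping unused coordinates of the simulator's sample space -/

section Unused

variable (t n : ℕ)

/-- Reading `Ω = blocks × seed × sample` as `seed × (blocks × sample)`. [folklore] -/
def seedOut : Ω t n ≃ List.Vector Bool n × ((Fin t → List.Vector Bool (2 * n)) × List.Vector Bool (2 * n)) where
  toFun ω := (ω.2.1, (ω.1, ω.2.2))
  invFun p := (p.2.1, p.1, p.2.2)
  left_inv _ := rfl
  right_inv _ := rfl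

/-- Reading `Ω` as `sample × (blocks × seed)`. [folklore] -/
def sampleOut : Ω t n ≃ List.Vector Bool (2 * n) × ((Fin t → List.Vector Bool (2 * n)) × List.Vector Bool n) where
  toFun ω := (ω.2.2, (ω.1, ω.2.1))
  invFun p := (p.2.1, p.2.2, p.1)
  left_inv _ := rfl
  right_inv _ := rfl

/-- An event on `Ω` that ignores the seed. [folklore] -/
theorem uProb_Ω_ignore_seed (F : (Fin t → List.Vector Bool (2 * n)) → List.Vector Bool (2 * n) → Bool) :
    uProb (fun ω : Ω t n => F ω.1 ω.2.2) =
      uProb (fun p : (Fin t → List.Vector Bool (2 * n)) × List.Vector Bool (2 * n) => F p.1 p.2) := by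
  rw [← uProb_comp_equiv (seedOut t n).symm (fun ω : Ω t n => F ω.1 ω.2.2)]
  exact uProb_snd (Ω := List.Vector Bool n) (fun p : (Fin t → List.Vector Bool (2 * n)) × List.Vector Bool (2 * n) => F p.1 p.2)

/-- An event on `Ω` that ignores the sample. [folklore] -/
theorem uProb_Ω_ignore_sample (F : (Fin t → List.Vector Bool (2 * n)) → List.Vector Bool n → Bool) :
    uProb (fun ω : Ω t n => F ω.1 ω.2.1) =
      uProb (fun p : (Fin t → List.Vector Bool (2 * n)) × List.Vector Bool n => F p.1 p.2) := by
  rw [← uProb_comp_equiv (sampleOut t n).symm (fun ω : Ω t n => F ω.1 ω.2.1)]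
  exact uProb_snd (Ω := List.Vector Bool (2 * n)) (fun p : (Fin t → List.Vector Bool (2 * n)) × List.Vector Bool n => F p.1 p.2)

/-- The (sample, block coins) of the distinguisher as (blocks, sample). [folklore] -/
noncomputable def sampleBlocksEquiv :
    List.Vector Bool (2 * n) × List.Vector Bool (2 * n * t) ≃ (Fin t → List.Vector Bool (2 * n)) × List.Vector Bool (2 * n) :=
  (Equiv.prodComm _ _).trans (Equiv.prodCongr (blocksEquivGGM n t) (Equiv.refl _))

/-- The (seed, block coins) of the distinguisher as (blocks, seed). [folklore] -/
noncomputable def seedBlocksEquiv :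
    List.Vector Bool n × List.Vector Bool (2 * n * t) ≃ (Fin t → List.Vector Bool (2 * n)) × List.Vector Bool n :=
  (Equiv.prodComm _ _).trans (Equiv.prodCongr (blocksEquivGGM n t) (Equiv.refl _))

end Unused

/-! ### The verdict of the distinguisher on genuine inputs -/

section Verdict

variable (𝒜 : OracleAdversary Bool) (G : List Bool → List Bool) (hG : ∀ s, (G s).length = 2 * s.length) (n : ℕ)

/-- The adversary's deterministic input `⟨1ⁿ, r_A⟩`. [folklore] -/
def xAv (rA : List.Vector Bool (cA 𝒜 n)) : List Bool := boolPair (unaryEncodeNat n) rA.toList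

/-- `Pr[pool U, (i, j)]` for coins `r_A`. [Goldreich 2001, proof of Thm. 3.6.6] [folklore] -/
noncomputable def PU (rA : List.Vector Bool (cA 𝒜 n)) (i j : ℕ) : ℝ :=
  uProb (fun ω : Ω (tA 𝒜 n) n => decide (lazyRunPair 𝒜.alg (xAv 𝒜 n rA) G n (tA 𝒜 n) i (poolU G n hG (tA 𝒜 n) j ω) = some true))

/-- `Pr[pool G, (i, j)]` for coins `r_A`. [Goldreich 2001, proof of Thm. 3.6.6] [folklore] -/
noncomputable def PG (rA : List.Vector Bool (cA 𝒜 n)) (i j : ℕ) : ℝ :=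
  uProb (fun ω : Ω (tA 𝒜 n) n => decide (lazyRunPair 𝒜.alg (xAv 𝒜 n rA) G n (tA 𝒜 n) i (poolG G n hG (tA 𝒜 n) j ω) = some true))

variable (rA : List.Vector Bool (cA 𝒜 n)) (a : List.Vector Bool (alphaOf n)) (b : List.Vector Bool (betaOf (tA 𝒜 n)))

/-- **The verdict on a genuine input**: the guard and the simulated run, with every field parsed.
[Goldreich 2001, p. 188] [folklore] -/
theorem run_distinguisher_genuine {s : List Bool} (hs : s.length = 2 * n) (rF : List Bool) :
    (distinguisher 𝒜 G).run (boolPair (unaryEncodeNat n) s) (rA.toList ++ a.toList ++ b.toList ++ rF) =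
      decide (bitsToNat a.toList < n ∧ bitsToNat b.toList < tA 𝒜 n ∧
        runRule 𝒜.alg (xAv 𝒜 n rA)
          (lazyRule 𝒜.alg (xAv 𝒜 n rA) (keyAt n (bitsToNat a.toList)) (postPairL G n (bitsToNat a.toList))
            (valL G n (bitsToNat b.toList) s rF)) (tA 𝒜 n) [] = some true) := by
  classical
  show simAccept 𝒜 G (genuine n s rA.toList a.toList b.toList rF) = _
  unfold simAccept
  have hrA : rA.toList.length = cA 𝒜 n := rA.toList_length
  have ha : a.toList.length = alphaOf n := a.toList_length
  have hb : b.toList.length = betaOf (tA 𝒜 n) := b.toList_length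
  have hmem : bitsToNat a.toList < n → bitsToNat b.toList < tA 𝒜 n →
      (genuine n s rA.toList a.toList b.toList rF ∈ simLang 𝒜 G ↔
        runRule 𝒜.alg (xAv 𝒜 n rA)
          (lazyRule 𝒜.alg (xAv 𝒜 n rA) (keyAt n (bitsToNat a.toList)) (postPairL G n (bitsToNat a.toList))
            (valL G n (bitsToNat b.toList) s rF)) (tA 𝒜 n) [] = some true) := fun h1 h2 => by
    show runRule _ _ _ _ _ = _ ↔ _
    unfold simRule
    rw [nOf_genuine, sOf_genuine hs, xAOf_genuine 𝒜 hrA, iOf_genuine 𝒜 hrA ha, jOf_genuine 𝒜 hrA ha hb,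
      rFOf_genuine 𝒜 hrA ha hb, min_eq_left h1.le, min_eq_left h2.le]
    rfl
  rw [nOf_genuine, iOf_genuine 𝒜 hrA ha, jOf_genuine 𝒜 hrA ha hb, Bool.eq_iff_iff, decide_eq_true_iff,
    decide_eq_true_iff]
  constructor
  · rintro ⟨h1, h2, h3⟩
    have h1' : bitsToNat a.toList < n := (min_lt_iff.1 h1).resolve_right (lt_irrefl _)
    have h2' : bitsToNat b.toList < tA 𝒜 n := (min_lt_iff.1 h2).resolve_right (lt_irrefl _)
    exact ⟨h1', h2', (hmem h1' h2').1 h3⟩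
  · rintro ⟨h1, h2, h3⟩
    exact ⟨min_lt_iff.2 (Or.inl h1), min_lt_iff.2 (Or.inl h2), (hmem h1 h2).2 h3⟩

/-- **Claim U** (uniform sample): averaged over the sample and the block coins, the verdict is
`Pr[pool U, (i, j)]` within the guard and `0` outside it. [Goldreich 2001, p. 189 (first bullet)] [folklore] -/
theorem uProb_run_uniform :
    uProb (fun q : List.Vector Bool (2 * n) × List.Vector Bool (2 * n * tA 𝒜 n) =>
      (distinguisher 𝒜 G).run (boolPair (unaryEncodeNat n) q.1.toList) (rA.toList ++ a.toList ++ b.toList ++ q.2.toList)) =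
      if bitsToNat a.toList < n ∧ bitsToNat b.toList < tA 𝒜 n then PU 𝒜 G hG n rA (bitsToNat a.toList) (bitsToNat b.toList) else 0 := by
  split_ifs with h
  · unfold PU
    have e1 : uProb (fun ω : Ω (tA 𝒜 n) n => decide (lazyRunPair 𝒜.alg (xAv 𝒜 n rA) G n (tA 𝒜 n) (bitsToNat a.toList)
          (poolU G n hG (tA 𝒜 n) (bitsToNat b.toList) ω) = some true)) =
        uProb (fun ω : Ω (tA 𝒜 n) n => decide (lazyRunPair 𝒜.alg (xAv 𝒜 n rA) G n (tA 𝒜 n) (bitsToNat a.toList)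
          (poolU G n hG (tA 𝒜 n) (bitsToNat b.toList) (ω.1, default, ω.2.2)) = some true)) :=
      uProb_congr fun _ => rfl
    rw [e1, uProb_Ω_ignore_seed (tA 𝒜 n) n (fun blk u =>
        decide (lazyRunPair 𝒜.alg (xAv 𝒜 n rA) G n (tA 𝒜 n) (bitsToNat a.toList)
          (poolU G n hG (tA 𝒜 n) (bitsToNat b.toList) (blk, default, u)) = some true)),
      ← uProb_comp_equiv (sampleBlocksEquiv (tA 𝒜 n) n)]
    refine uProb_congr fun q => ?_
    rw [run_distinguisher_genuine 𝒜 G n rA a b q.1.toList_length]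
    simp only [h, true_and]
    congr 1
    rw [runRule_valL_eq_lazyRunPair_poolU G n hG 𝒜.alg (xAv 𝒜 n rA)
      (blocksOf_blocksEquivGGM n (tA 𝒜 n) q.2) default q.1]
    rfl
  · rw [← uProb_false' (Ω₀ := List.Vector Bool (2 * n) × List.Vector Bool (2 * n * tA 𝒜 n))]
    refine uProb_congr fun q => ?_
    rw [run_distinguisher_genuine 𝒜 G n rA a b q.1.toList_length, decide_eq_false_iff_not]
    exact fun h' => h ⟨h'.1, h'.2.1⟩

/-- **Claim G** (pseudorandom sample `G σ`): averaged over the seed and the block coins, the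
verdict is `Pr[pool G, (i, j)]` within the guard and `0` outside it.
[Goldreich 2001, p. 189 (second bullet)] [folklore] -/
theorem uProb_run_map :
    uProb (fun q : List.Vector Bool n × List.Vector Bool (2 * n * tA 𝒜 n) =>
      (distinguisher 𝒜 G).run (boolPair (unaryEncodeNat n) (G q.1.toList)) (rA.toList ++ a.toList ++ b.toList ++ q.2.toList)) =
      if bitsToNat a.toList < n ∧ bitsToNat b.toList < tA 𝒜 n then PG 𝒜 G hG n rA (bitsToNat a.toList) (bitsToNat b.toList) else 0 := by
  split_ifs with h
  · unfold PG
    have e1 : uProb (fun ω : Ω (tA 𝒜 n) n => decide (lazyRunPair 𝒜.alg (xAv 𝒜 n rA) G n (tA 𝒜 n) (bitsToNat a.toList)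
          (poolG G n hG (tA 𝒜 n) (bitsToNat b.toList) ω) = some true)) =
        uProb (fun ω : Ω (tA 𝒜 n) n => decide (lazyRunPair 𝒜.alg (xAv 𝒜 n rA) G n (tA 𝒜 n) (bitsToNat a.toList)
          (poolG G n hG (tA 𝒜 n) (bitsToNat b.toList) (ω.1, ω.2.1, default)) = some true)) :=
      uProb_congr fun _ => rfl
    rw [e1, uProb_Ω_ignore_sample (tA 𝒜 n) n (fun blk σ =>
        decide (lazyRunPair 𝒜.alg (xAv 𝒜 n rA) G n (tA 𝒜 n) (bitsToNat a.toList)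
          (poolG G n hG (tA 𝒜 n) (bitsToNat b.toList) (blk, σ, default)) = some true)),
      ← uProb_comp_equiv (seedBlocksEquiv (tA 𝒜 n) n)]
    refine uProb_congr fun q => ?_
    rw [run_distinguisher_genuine 𝒜 G n rA a b (by rw [hG, q.1.toList_length])]
    simp only [h, true_and]
    congr 1
    rw [runRule_valL_eq_lazyRunPair_poolG G n hG 𝒜.alg (xAv 𝒜 n rA)
      (blocksOf_blocksEquivGGM n (tA 𝒜 n) q.2) q.1 default]
    rfl
  · rw [← uProb_false' (Ω₀ := List.Vector Bool n × List.Vector Bool (2 * n * tA 𝒜 n))]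
    refine uProb_congr fun q => ?_
    rw [run_distinguisher_genuine 𝒜 G n rA a b (by rw [hG, q.1.toList_length]), decide_eq_false_iff_not]
    exact fun h' => h ⟨h'.1, h'.2.1⟩

end Verdict

/-! ### Averaging over the coins: the exact identity -/

section Identity

variable (𝒜 : OracleAdversary Bool) (G : List Bool → List Bool) (hG : ∀ s, (G s).length = 2 * s.length) (n : ℕ)

/-- The triples (adversary coins, level bits, slot bits). [folklore] -/
abbrev ABC : Type := (List.Vector Bool (cA 𝒜 n) × List.Vector Bool (alphaOf n)) × List.Vector Bool (betaOf (tA 𝒜 n))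

/-- **Joining the coins**: `(((r_A, a), b), r_F) ↦ r_A ‖ a ‖ b ‖ r_F`, a bijection onto the
distinguisher's coin space. [folklore] -/
noncomputable def coinJoin : ABC 𝒜 n × List.Vector Bool (2 * n * tA 𝒜 n) ≃ List.Vector Bool (Ltot 𝒜 n) :=
  (Equiv.prodCongr (((Equiv.prodCongr (splitEquiv (cA 𝒜 n) (alphaOf n)).symm (Equiv.refl _)).trans
    (splitEquiv (cA 𝒜 n + alphaOf n) (betaOf (tA 𝒜 n))).symm)) (Equiv.refl _)).trans
    (splitEquiv (cA 𝒜 n + alphaOf n + betaOf (tA 𝒜 n)) (2 * n * tA 𝒜 n)).symm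

/-- The string of the joined coins. [folklore] -/
theorem toList_coinJoin (q : ABC 𝒜 n × List.Vector Bool (2 * n * tA 𝒜 n)) :
    (coinJoin 𝒜 n q).toList = q.1.1.1.toList ++ q.1.1.2.toList ++ q.1.2.toList ++ q.2.toList := rfl

/-- `(abc, (s, r_F)) ↦ (s, (abc, r_F))`. [folklore] -/
def assocSwap (S : Type) : ABC 𝒜 n × (S × List.Vector Bool (2 * n * tA 𝒜 n)) ≃ S × (ABC 𝒜 n × List.Vector Bool (2 * n * tA 𝒜 n)) where
  toFun p := (p.2.1, (p.1, p.2.2))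
  invFun p := (p.2.1, (p.1, p.2.2))
  left_inv _ := rfl
  right_inv _ := rfl

/-- The number of triples. [folklore] -/
theorem card_ABC : (Fintype.card (ABC 𝒜 n) : ℝ) = 2 ^ cA 𝒜 n * 2 ^ alphaOf n * 2 ^ betaOf (tA 𝒜 n) := by
  simp [Fintype.card_prod, card_vector]

/-- `Pr[M^{f_{U_n}}(1ⁿ) = 1]` for coins `r_A` (the real game at fixed coins). [Goldreich 2001, p. 187] [folklore] -/
noncomputable def hReal (rA : List.Vector Bool (cA 𝒜 n)) : ℝ :=
  uProb (fun k : List.Vector Bool n =>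
    decide (𝒜.alg.runAux (oracleOfFnAt n (ggmEnsemble G n k.toList)) (xAv 𝒜 n rA) (tA 𝒜 n) [] = some true))

/-- `Pr[M^{H_n}(1ⁿ) = 1]` for coins `r_A` (the ideal game at fixed coins). [Goldreich 2001, p. 187] [folklore] -/
noncomputable def hIdeal (rA : List.Vector Bool (cA 𝒜 n)) : ℝ :=
  uProb (fun T : List.Vector Bool n → List.Vector Bool n =>
    decide (𝒜.alg.runAux (oracleOfTable T) (xAv 𝒜 n rA) (tA 𝒜 n) [] = some true))

/-- **The real game is the average over the coins of the fixed-coin real game.** [folklore] -/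
theorem prfRealProb_eq_avg :
    prfRealProb (ggmEnsemble G) id id 𝒜 n = (∑ rA, hReal 𝒜 G n rA) / 2 ^ cA 𝒜 n := by
  rw [prfRealProb_eq_uProb, ← uProb_comp_equiv (Equiv.prodComm _ _), uProb_prod_eq_avg, card_vector,
    Fintype.card_bool]
  push_cast
  rfl

/-- **The ideal game is the average over the coins of the fixed-coin ideal game.** [folklore] -/
theorem prfIdealProb_eq_avg :
    prfIdealProb id id 𝒜 n = (∑ rA, hIdeal 𝒜 n rA) / 2 ^ cA 𝒜 n := by
  rw [prfIdealProb_eq_uProb, ← uProb_comp_equiv (Equiv.prodComm _ _), uProb_prod_eq_avg, card_vector,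
    Fintype.card_bool]
  push_cast
  rfl

/-- The guarded gap at `(i, j)`. [folklore] -/
noncomputable def gap (rA : List.Vector Bool (cA 𝒜 n)) (i j : ℕ) : ℝ :=
  if i < n ∧ j < tA 𝒜 n then PG 𝒜 G hG n rA i j - PU 𝒜 G hG n rA i j else 0

/-- The slot sum of the guarded gaps at level `i`. [folklore] -/
theorem sum_gap_slot (rA : List.Vector Bool (cA 𝒜 n)) (i : ℕ) :
    ∑ j ∈ range (2 ^ betaOf (tA 𝒜 n)), gap 𝒜 G hG n rA i j =
      if i < n then ∑ j ∈ range (tA 𝒜 n), (PG 𝒜 G hG n rA i j - PU 𝒜 G hG n rA i j) else 0 := by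
  unfold gap
  split_ifs with hi
  · rw [← sum_range_ite_lt (le_two_pow_alphaOf (tA 𝒜 n))]
    refine Finset.sum_congr rfl fun j _ => ?_
    simp [hi]
  · refine Finset.sum_eq_zero fun j _ => ?_
    simp [hi]

/-- **The double sum of the guarded gaps telescopes to the gap between the games** (at fixed coins).
[GGM 1986, p. 802; Goldreich 2001, p. 192] [folklore] -/
theorem sum_sum_gap (ht : 0 < tA 𝒜 n) (rA : List.Vector Bool (cA 𝒜 n)) :
    ∑ a : List.Vector Bool (alphaOf n), ∑ b : List.Vector Bool (betaOf (tA 𝒜 n)),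
        gap 𝒜 G hG n rA (bitsToNat a.toList) (bitsToNat b.toList) = hReal 𝒜 G n rA - hIdeal 𝒜 n rA := by
  have h1 : ∀ a : List.Vector Bool (alphaOf n),
      ∑ b : List.Vector Bool (betaOf (tA 𝒜 n)), gap 𝒜 G hG n rA (bitsToNat a.toList) (bitsToNat b.toList) =
        ∑ j ∈ range (2 ^ betaOf (tA 𝒜 n)), gap 𝒜 G hG n rA (bitsToNat a.toList) j := fun a =>
    sum_vector_bitsToNat (betaOf (tA 𝒜 n)) (gap 𝒜 G hG n rA (bitsToNat a.toList))
  simp_rw [h1, sum_gap_slot]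
  rw [sum_vector_bitsToNat (alphaOf n)
      (fun i => if i < n then ∑ j ∈ range (tA 𝒜 n), (PG 𝒜 G hG n rA i j - PU 𝒜 G hG n rA i j) else 0),
    sum_range_ite_lt (le_two_pow_alphaOf n)]
  unfold PG PU
  rw [sum_sum_uProb_poolG_sub_poolU 𝒜.alg (xAv 𝒜 n rA) G n hG (tA 𝒜 n) true ht, uProb_hybRun_zero,
    uProb_hybRun_self]
  rfl

include hG in
/-- **The exact identity of the GGM reduction** (uniform-slot and level averaging):
`Pr[D(G(U_n)) = 1] − Pr[D(U_{2n}) = 1] = (prfReal(n) − prfIdeal(n)) / 2^{α+β}`.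
[GGM 1986, p. 802 ("The probability that `A_T` outputs 1 … is `Σ (1/k)·p_k^i`"); Goldreich 2001,
p. 192 (`= Δ(n)/n`) with Thm. 3.2.6] [folklore] -/
theorem acceptPMF_map_sub_acceptPMF_uniform (ht : 0 < tA 𝒜 n) :
    (acceptPMF (distinguisher 𝒜 G) n ((uniformBits n).map G) true).toReal -
        (acceptPMF (distinguisher 𝒜 G) n (uniformBits (2 * n)) true).toReal =
      (prfRealProb (ggmEnsemble G) id id 𝒜 n - prfIdealProb id id 𝒜 n) /
        (2 ^ alphaOf n * 2 ^ betaOf (tA 𝒜 n)) := by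
  have HU : (acceptPMF (distinguisher 𝒜 G) n (uniformBits (2 * n)) true).toReal =
      (∑ abc : ABC 𝒜 n, if bitsToNat abc.1.2.toList < n ∧ bitsToNat abc.2.toList < tA 𝒜 n then
        PU 𝒜 G hG n abc.1.1 (bitsToNat abc.1.2.toList) (bitsToNat abc.2.toList) else 0) / Fintype.card (ABC 𝒜 n) := by
    rw [acceptPMF_distinguisher_uniform,
      ← uProb_comp_equiv (Equiv.prodCongr (Equiv.refl _) (coinJoin 𝒜 n)),
      ← uProb_comp_equiv (assocSwap 𝒜 n (List.Vector Bool (2 * n))), uProb_prod_eq_avg]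
    congr 1
    refine Finset.sum_congr rfl fun abc _ => ?_
    obtain ⟨⟨rA, a⟩, b⟩ := abc
    exact uProb_run_uniform 𝒜 G hG n rA a b
  have HG : (acceptPMF (distinguisher 𝒜 G) n ((uniformBits n).map G) true).toReal =
      (∑ abc : ABC 𝒜 n, if bitsToNat abc.1.2.toList < n ∧ bitsToNat abc.2.toList < tA 𝒜 n then
        PG 𝒜 G hG n abc.1.1 (bitsToNat abc.1.2.toList) (bitsToNat abc.2.toList) else 0) / Fintype.card (ABC 𝒜 n) := by
    rw [acceptPMF_distinguisher_map 𝒜 G hG,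
      ← uProb_comp_equiv (Equiv.prodCongr (Equiv.refl _) (coinJoin 𝒜 n)),
      ← uProb_comp_equiv (assocSwap 𝒜 n (List.Vector Bool n)), uProb_prod_eq_avg]
    congr 1
    refine Finset.sum_congr rfl fun abc _ => ?_
    obtain ⟨⟨rA, a⟩, b⟩ := abc
    exact uProb_run_map 𝒜 G hG n rA a b
  have HS : ∑ abc : ABC 𝒜 n,
      ((if bitsToNat abc.1.2.toList < n ∧ bitsToNat abc.2.toList < tA 𝒜 n then
          PG 𝒜 G hG n abc.1.1 (bitsToNat abc.1.2.toList) (bitsToNat abc.2.toList) else 0) -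
        (if bitsToNat abc.1.2.toList < n ∧ bitsToNat abc.2.toList < tA 𝒜 n then
          PU 𝒜 G hG n abc.1.1 (bitsToNat abc.1.2.toList) (bitsToNat abc.2.toList) else 0)) =
      ∑ rA : List.Vector Bool (cA 𝒜 n), (hReal 𝒜 G n rA - hIdeal 𝒜 n rA) := by
    rw [Fintype.sum_prod_type, Fintype.sum_prod_type]
    refine Finset.sum_congr rfl fun rA _ => ?_
    rw [← sum_sum_gap 𝒜 G hG n ht rA]
    refine Finset.sum_congr rfl fun a _ => Finset.sum_congr rfl fun b _ => ?_
    unfold gap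
    split_ifs <;> simp
  rw [HG, HU, ← sub_div, ← Finset.sum_sub_distrib, HS, prfRealProb_eq_avg, prfIdealProb_eq_avg, card_ABC,
    ← sub_div, ← Finset.sum_sub_distrib]
  have h2 : (2 : ℝ) ^ cA 𝒜 n ≠ 0 := pow_ne_zero _ two_ne_zero
  have h3 : (2 : ℝ) ^ alphaOf n ≠ 0 := pow_ne_zero _ two_ne_zero
  have h4 : (2 : ℝ) ^ betaOf (tA 𝒜 n) ≠ 0 := pow_ne_zero _ two_ne_zero
  field_simp

/-- With no rounds the games coincide (no output is ever produced). [folklore] -/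
theorem prfRealProb_eq_prfIdealProb_of_tA_eq_zero (ht : tA 𝒜 n = 0) :
    prfRealProb (ggmEnsemble G) id id 𝒜 n = prfIdealProb id id 𝒜 n := by
  rw [prfRealProb_eq_uProb, prfIdealProb_eq_uProb, ht]
  rw [show (fun p : List.Vector Bool n × List.Vector Bool (cA 𝒜 n) =>
      decide (𝒜.alg.run (oracleOfFnAt n (ggmEnsemble G n p.1.toList)) 0
        (boolPair (unaryEncodeNat n) p.2.toList) = some true)) = fun _ => false from funext fun _ => rfl,
    show (fun p : (List.Vector Bool n → List.Vector Bool n) × List.Vector Bool (cA 𝒜 n) =>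
      decide (𝒜.alg.run (oracleOfTable p.1) 0 (boolPair (unaryEncodeNat n) p.2.toList) = some true)) =
      fun _ => false from funext fun _ => rfl, uProb_false', uProb_false']

/-- `2^α · 2^β ≤ 4 (n + 1) (t + 1)`. [folklore] -/
theorem two_pow_mul_two_pow_le : (2 : ℝ) ^ alphaOf n * 2 ^ betaOf (tA 𝒜 n) ≤ 4 * (n + 1) * (tA 𝒜 n + 1) := by
  have h1 := two_pow_alphaOf_le n
  have h2 := two_pow_alphaOf_le (tA 𝒜 n)
  have h1' : (2 : ℝ) ^ alphaOf n ≤ 2 * (n + 1) := by exact_mod_cast h1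
  have h2' : (2 : ℝ) ^ betaOf (tA 𝒜 n) ≤ 2 * (tA 𝒜 n + 1) := by unfold betaOf; exact_mod_cast h2
  calc (2 : ℝ) ^ alphaOf n * 2 ^ betaOf (tA 𝒜 n) ≤ (2 * (n + 1)) * (2 * (tA 𝒜 n + 1)) :=
        mul_le_mul h1' h2' (by positivity) (by positivity)
    _ = 4 * (n + 1) * (tA 𝒜 n + 1) := by ring

include hG in
/-- **The advantage bound of the GGM reduction**: the PRF advantage of `𝒜` against the tree
ensemble is at most `4 (n+1) (t(n)+1)` times the distinguishing advantage of `D` between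
`G(U_n)` and `U_{2n}`. [GGM 1986, p. 802 ("differ by at least `(1/k)·|p_k^0 − p_k^k|`");
Goldreich 2001, p. 192 with Thm. 3.2.6] [folklore] -/
theorem prfAdvantage_le_mul_distAdvantage :
    prfAdvantage (ggmEnsemble G) id id id 𝒜 n ≤
      (4 * (n + 1) * (tA 𝒜 n + 1)) *
        distAdvantage (distinguisher 𝒜 G) (fun n => (uniformBits n).map G) (uniformEnsemble fun n => 2 * n) n := by
  unfold prfAdvantage distAdvantage uniformEnsemble
  rcases Nat.eq_zero_or_pos (tA 𝒜 n) with ht | ht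
  · rw [prfRealProb_eq_prfIdealProb_of_tA_eq_zero 𝒜 G n ht, sub_self, abs_zero]
    positivity
  · have hpos : (0 : ℝ) < 2 ^ alphaOf n * 2 ^ betaOf (tA 𝒜 n) := by positivity
    have h := acceptPMF_map_sub_acceptPMF_uniform 𝒜 G hG n ht
    rw [eq_div_iff hpos.ne'] at h
    rw [← h, abs_mul, abs_of_pos hpos, mul_comm]
    exact mul_le_mul_of_nonneg_right (two_pow_mul_two_pow_le 𝒜 n) (abs_nonneg _)

end Identity

/-! ### The Main Theorem -/

section Main

/-- The polynomial `4 (X + 1) (fuel + 1)` of the advantage bound, over `ℝ`. [folklore] -/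
noncomputable def boundPoly (𝒜 : OracleAdversary Bool) : Polynomial ℝ :=
  4 * (Polynomial.X + 1) * (Polynomial.map (Nat.castRingHom ℝ) 𝒜.fuel + 1)

/-- Value of the bound polynomial. [folklore] -/
theorem boundPoly_eval (𝒜 : OracleAdversary Bool) (n : ℕ) :
    (boundPoly 𝒜).eval (n : ℝ) = 4 * (n + 1) * (tA 𝒜 n + 1) := by
  simp [boundPoly, tA, Polynomial.eval_natCast_map]

/-- **GGM 1986, Thm. 3 (Main Theorem); Goldreich 2001, Thm. 3.6.6** — discharge of the named fact
`Literature.Computability.Cryptography.GGM1986_thm3`: for a length-doubling pseudorandom generator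
`G`, every probabilistic polynomial-time oracle adversary has negligible advantage in the PRF game
against the GGM tree ensemble `ggmEnsemble G`. Proof as printed: the PPT distinguisher
`D = GGMHyb.distinguisher 𝒜 G` (uniform level `i` and sample slot `j`, lazy sampling of the
level-`i` labels, `GGMSimulator.lean` for its running time) has advantage
`(prfReal − prfIdeal)/2^{α+β}` exactly (`acceptPMF_map_sub_acceptPMF_uniform`: the lazy/eager
principle at the extreme slots, a coordinate permutation between neighbouring slots, telescoping
over slots and levels), so `prfAdvantage ≤ 4(n+1)(t(n)+1) · distAdvantage D`, negligible since
`D`'s advantage is (pseudorandomness of `G`) and the factor is a polynomial.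
[GGM 1986, §3.3, Thm. 3, proof pp. 800–802; Goldreich 2001, Thm. 3.6.6, proof pp. 187–192]
[cite: GGM1986, Thm. 3] -/
theorem _root_.Literature.Computability.Cryptography.GGM1986_thm3_holds : GGM1986_thm3 := by
  intro G hG 𝒜 h𝒜
  have hD : IsPPT (distinguisher 𝒜 G) encodeBool :=
    distinguisher_isPPT 𝒜 G h𝒜 hG.polyTimeComputable hG.length_eq
  have hneg := hG.isPseudorandom (distinguisher 𝒜 G) hD
  have hmul := hneg.polynomial_mul (boundPoly 𝒜)
  refine hmul.trans_abs_le fun n => ?_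
  rw [boundPoly_eval, abs_of_nonneg (prfAdvantage_nonneg _ _ _ _ _ _),
    abs_of_nonneg (mul_nonneg (by positivity) (distAdvantage_nonneg _ _ _ _))]
  exact prfAdvantage_le_mul_distAdvantage 𝒜 G hG.length_eq n

end Main

end GGMHyb

end Literature.Computability.Cryptography
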